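import Summits.ResolutionOfSingularities.ResolutionOfSingularities.Theorems.WeightedInvariantLocalWeightedDropNCDirectrixCutTschirnhaus
import Summits.ResolutionOfSingularities.ResolutionOfSingularities.Theorems.WeightedInvariantLocalWeightedDropNCDirectrixCutHist
import Summits.ResolutionOfSingularities.ResolutionOfSingularities.Theorems.WeightedInvariantLocalWeightedDropNCDirectrixCutPosition
import Summits.ResolutionOfSingularities.ResolutionOfSingularities.Theorems.WeightedInvariantLocalWeightedDropNCDirectrixCutSmoothPairTwo

/-!
# `WeightedInvariant.LocalWeightedDrop` (stmt-ResolutionOfSingularities-8899), registered stub W′|₄ `stub_wildWideApexFourStartsWon`: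
# THE UNARY POSITION GLUE IN THE TREE — W₃ and FT₃ from their named leaves, the `(2, 2)` GOOD corner fed by C

[OURS · route `ResolutionOfSingularities/WeightedInvariant` · ENGINE crux `LocalWeightedDrop` (stmt-ResolutionOfSingularities-8899), skeleton v36
`ae852bbacee88029`, registered stub W′|₄ · res-L1-w43-strat-1's unary position split (`g10/unary_position_split_v2.lean`, Part C glue kernel-checked
there modulo six stubs; Part A = the tree's `…NCDirectrixCutPosition`).  Candidates of the programme's own count game; nothing here is a statement
of, or about, any manuscript; AI-written, weaker than expert review; counted 0; proves no summit and closes no registered stub.]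

## What this file does (the strategist's proved glue VERBATIM, stubs turned into explicit hypotheses; no definition, no new axiom)

* `tschirnhausWitnessOfGood` (PROVED, from the tree's `Decoration.exists_tschirnhausWitness_of_goodDir`), `unaryThree_of_positions` (PROVED: the
  LETTER → {GOOD, BAD} → GOOD position glue by `DWinsTo.bind`, initial position by `Decoration.position_trichotomy`),
  `coreUnaryWildGoodThree_of_orders`, `freeTameGoodThree_of` — res-L1-w43-strat-1 g10, verbatim;
* `coreUnaryWildThree_of_leaves` — **W₃ = `CoreUnaryWild p k 3` (v3f `stub_coreUnaryWildThree` VERBATIM) ⟸ LETTER escape ∧ BAD escape ∧ C ∧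
  odd-`p` GOOD core ∧ higher GOOD core**, where the `(p, o) = (2, 2)` GOOD corner is no longer a leaf: it is `charTwoUnaryDoublePointsGood_of_cpScope`
  (`…NCDirectrixCutSmoothPairTwo`, this hand: F ✓ T ✓ R₂ ✓) fed with C = `stub_cpScopeIrredOrderP` VERBATIM;
* `freeTameThree_of_leaves` — **FT₃ = `FreeTame p k 3` (v3f `stub_freeTameThree` VERBATIM) ⟸ LETTER escape ∧ BAD escape ∧ FT₃-GOOD
  (`stub_freeTameGoodTschirnhaus`)**.
Together with `WildFourCensus.wildWideApexFourStartsWon_of_leaves` (`…NCDirectrixCutWildFourOfLeaves`, this hand) the registered stub W′|₄ is, in the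
kernel, a consequence of exactly: LETTER escape (KM16-class, XL) · BAD escape (dimension ≤ 2 order reduction, L) · FT₃-GOOD (KM16-class, XL) ·
C (Cossart–Piltant 2019 engine port = PREP ⊕ RUN, with sub-gap (d2′)) · odd-`p` GOOD core (⟸ R ∧ C ∧ `stub_irredOutsideCPScopeOddP`, the last NOT
in print) · higher GOOD core (`p ∣ o ≠ p`, NOT in print) · LOW₃ (CJS-class, open sub-case Q-LOW-1).
-/

set_option linter.dupNamespace false -- mandated namespace of this single-conjunct summit

noncomputable section

namespace Summit.ResolutionOfSingularities.ResolutionOfSingularities.Theorems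

namespace TameFourTupleDrop

namespace UnaryPositionCensus

open MvPowerSeries Literature.AlgebraicGeometry.Resolution

/-! ## §1 The strategist's glue (res-L1-w43-strat-1 `unary_position_split_v2.lean` Part C, verbatim) -/

/-- **(t1) `tschirnhausWitnessOfGood` — PROVED** from the landed `Decoration.exists_tschirnhausWitness_of_goodDir` (p555907). -/
theorem tschirnhausWitnessOfGood :
    ∀ (p : ℕ), p.Prime → ∀ (k : Type) [Field k] [CharP k p] [IsAlgClosed k],
      ∀ (b : MvPowerSeries (Fin 4) k) (δ : Decoration k 3), Admissible b δ → 2 ≤ δ.o → δ.O = ∅ → UnaryVertex δ → ¬ p ∣ δ.o → δ.GoodDir →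
        ∃ (Φ : Fin 4 → MvPowerSeries (Fin 4) k) (u : MvPowerSeries (Fin 4) k) (a : ℕ → MvPowerSeries (Fin 4) k),
          (∀ i, constantCoeff (Φ i) = 0) ∧ IsUnit (Matrix.det (Matrix.of fun i j => coeff (Finsupp.single j 1) (Φ i))) ∧
          (∀ l ∈ δ.E, ∃ (l' : Fin 4) (v : MvPowerSeries (Fin 4) k), l' ≠ 0 ∧ constantCoeff v ≠ 0 ∧ Φ l = v * X l') ∧
          constantCoeff u ≠ 0 ∧ (∀ (i : ℕ) (n : Fin 4 →₀ ℕ), n 0 ≠ 0 → coeff n (a i) = 0) ∧ a (δ.o - 1) = 0 ∧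
          subst Φ δ.f = u * (X 0 ^ δ.o + ∑ i ∈ Finset.range δ.o, a i * X 0 ^ i) := by
  intro p hp k _ _ _ b δ hadm ho hO hU hndvd hg
  have hchar : (δ.o : k) ≠ 0 := by
    rw [ne_eq, CharP.cast_eq_zero_iff k p]
    exact hndvd
  exact Decoration.exists_tschirnhausWitness_of_goodDir hadm.2.1.ne_zero (by omega) hg hchar

/-- **THE POSITION GLUE** (generic in the order predicate `Q`: `Q = (p ∣ ·)` for W₃, `Q = (¬ p ∣ ·)` for FT₃): from the LETTER escape, the BAD escape and
a GOOD-position win, every admissible unary vertex with `O = ∅`, `o ≥ 2`, `Q o` is won.  LETTER ⟶ {GOOD, BAD}, BAD ⟶ GOOD by `DWinsTo.bind` (no cycle),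
targets transported along the equality of heads; the initial position by `Decoration.exists_isDirForm_of_unaryVertex` + `Decoration.position_trichotomy` (tree). -/
theorem unaryThree_of_positions {p : ℕ} (hp : p.Prime) {k : Type} [Field k] [CharP k p] [IsAlgClosed k] (Q : ℕ → Prop)
    (hL : ∀ (b : MvPowerSeries (Fin 4) k) (δ : Decoration k 3) (l : Fin 4), Admissible b δ → 2 ≤ δ.o → UnaryVertex δ → δ.LetterDir l →
        DWinsTo (St := MvPowerSeries (Fin 4) k × Decoration k 3) Prod.fst
          (fun τ => (GermIsNC τ.1 ∨ (Admissible τ.1 τ.2 ∧ (τ.2.head < δ.head ∨ (τ.2.head = δ.head ∧ ¬ UnaryVertex τ.2)))) ∨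
            (Admissible τ.1 τ.2 ∧ τ.2.head = δ.head ∧ UnaryVertex τ.2 ∧ (τ.2.GoodDir ∨ τ.2.BadDir))) (b, δ))
    (hB : ∀ (b : MvPowerSeries (Fin 4) k) (δ : Decoration k 3), Admissible b δ → 2 ≤ δ.o → UnaryVertex δ → δ.BadDir →
        DWinsTo (St := MvPowerSeries (Fin 4) k × Decoration k 3) Prod.fst
          (fun τ => (GermIsNC τ.1 ∨ (Admissible τ.1 τ.2 ∧ (τ.2.head < δ.head ∨ (τ.2.head = δ.head ∧ ¬ UnaryVertex τ.2)))) ∨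
            (Admissible τ.1 τ.2 ∧ τ.2.head = δ.head ∧ UnaryVertex τ.2 ∧ τ.2.GoodDir)) (b, δ))
    (hG : ∀ (b : MvPowerSeries (Fin 4) k) (δ : Decoration k 3), Admissible b δ → 2 ≤ δ.o → UnaryVertex δ → δ.O = ∅ → Q δ.o → δ.GoodDir →
        DWinsTo (St := MvPowerSeries (Fin 4) k × Decoration k 3) Prod.fst
          (fun τ => GermIsNC τ.1 ∨ (Admissible τ.1 τ.2 ∧ (τ.2.head < δ.head ∨ (τ.2.head = δ.head ∧ ¬ UnaryVertex τ.2)))) (b, δ)) :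
    ∀ (b : MvPowerSeries (Fin 4) k) (δ : Decoration k 3), Admissible b δ → 2 ≤ δ.o → UnaryVertex δ → δ.O = ∅ → Q δ.o →
      DWinsTo (St := MvPowerSeries (Fin 4) k × Decoration k 3) Prod.fst
        (fun τ => GermIsNC τ.1 ∨ (Admissible τ.1 τ.2 ∧ (τ.2.head < δ.head ∨ (τ.2.head = δ.head ∧ ¬ UnaryVertex τ.2)))) (b, δ) := by
  have _hp := hp
  intro b δ hadm ho hU hO hQ
  -- GOOD positions with the head of `δ` are won towards the target of `δ`
  have hGood : ∀ (b' : MvPowerSeries (Fin 4) k) (δ' : Decoration k 3), Admissible b' δ' → δ'.head = δ.head → UnaryVertex δ' → δ'.GoodDir →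
      DWinsTo (St := MvPowerSeries (Fin 4) k × Decoration k 3) Prod.fst
        (fun τ => GermIsNC τ.1 ∨ (Admissible τ.1 τ.2 ∧ (τ.2.head < δ.head ∨ (τ.2.head = δ.head ∧ ¬ UnaryVertex τ.2)))) (b', δ') := by
    intro b' δ' hadm' hhead hU' hg'
    have ho' : δ'.o = δ.o := Decoration.o_eq_of_head_eq hhead
    refine (hG b' δ' hadm' (by rw [ho']; exact ho) hU' hg'.1 (by rw [ho']; exact hQ) hg').mono fun τ hτ => ?_
    rcases hτ with hnc | ⟨hadmτ, hlt | ⟨heq, hnu⟩⟩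
    · exact Or.inl hnc
    · exact Or.inr ⟨hadmτ, Or.inl (lt_of_lt_of_eq hlt hhead)⟩
    · exact Or.inr ⟨hadmτ, Or.inr ⟨heq.trans hhead, hnu⟩⟩
  -- BAD positions with the head of `δ`: escape to GOOD, then `hGood`
  have hBad : ∀ (b' : MvPowerSeries (Fin 4) k) (δ' : Decoration k 3), Admissible b' δ' → δ'.head = δ.head → UnaryVertex δ' → δ'.BadDir →
      DWinsTo (St := MvPowerSeries (Fin 4) k × Decoration k 3) Prod.fst
        (fun τ => GermIsNC τ.1 ∨ (Admissible τ.1 τ.2 ∧ (τ.2.head < δ.head ∨ (τ.2.head = δ.head ∧ ¬ UnaryVertex τ.2)))) (b', δ') := by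
    intro b' δ' hadm' hhead hU' hbad
    have ho' : δ'.o = δ.o := Decoration.o_eq_of_head_eq hhead
    refine (hB b' δ' hadm' (by rw [ho']; exact ho) hU' hbad).bind fun τ hτ => ?_
    obtain ⟨b'', δ''⟩ := τ
    rcases hτ with hT | ⟨hadm'', hhead'', hU'', hg''⟩
    · refine DWinsTo.of_target ?_
      rcases hT with hnc | ⟨hadmτ, hlt | ⟨heq, hnu⟩⟩
      · exact Or.inl hnc
      · exact Or.inr ⟨hadmτ, Or.inl (lt_of_lt_of_eq hlt hhead)⟩
      · exact Or.inr ⟨hadmτ, Or.inr ⟨heq.trans hhead, hnu⟩⟩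
    · exact hGood b'' δ'' hadm'' (hhead''.trans hhead) hU'' hg''
  -- LETTER positions with the head of `δ`: escape to GOOD or BAD
  have hLetter : ∀ (b' : MvPowerSeries (Fin 4) k) (δ' : Decoration k 3) (l : Fin 4), Admissible b' δ' → δ'.head = δ.head → UnaryVertex δ' →
      δ'.LetterDir l →
      DWinsTo (St := MvPowerSeries (Fin 4) k × Decoration k 3) Prod.fst
        (fun τ => GermIsNC τ.1 ∨ (Admissible τ.1 τ.2 ∧ (τ.2.head < δ.head ∨ (τ.2.head = δ.head ∧ ¬ UnaryVertex τ.2)))) (b', δ') := by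
    intro b' δ' l hadm' hhead hU' hl
    have ho' : δ'.o = δ.o := Decoration.o_eq_of_head_eq hhead
    refine (hL b' δ' l hadm' (by rw [ho']; exact ho) hU' hl).bind fun τ hτ => ?_
    obtain ⟨b'', δ''⟩ := τ
    rcases hτ with hT | ⟨hadm'', hhead'', hU'', hg'' | hb''⟩
    · refine DWinsTo.of_target ?_
      rcases hT with hnc | ⟨hadmτ, hlt | ⟨heq, hnu⟩⟩
      · exact Or.inl hnc
      · exact Or.inr ⟨hadmτ, Or.inl (lt_of_lt_of_eq hlt hhead)⟩
      · exact Or.inr ⟨hadmτ, Or.inr ⟨heq.trans hhead, hnu⟩⟩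
    · exact hGood b'' δ'' hadm'' (hhead''.trans hhead) hU'' hg''
    · exact hBad b'' δ'' hadm'' (hhead''.trans hhead) hU'' hb''
  -- the initial position
  obtain ⟨ℓ, hℓ⟩ := Decoration.exists_isDirForm_of_unaryVertex hadm (by omega) hU
  rcases Decoration.position_trichotomy hO hℓ with hg | ⟨l, hl⟩ | hbad
  · exact hGood b δ hadm rfl hU hg
  · exact hLetter b δ l hadm rfl hU hl
  · exact hBad b δ hadm rfl hU hbad

/-- **W₃ IN GOOD POSITION, BY ORDER CLASS** (kernel-checked dispatch, as in w3_split_v5): `(p, o) = (2, 2)` · `o = p` odd · `p ∣ o ≠ p`. -/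
theorem coreUnaryWildGoodThree_of_orders
    (h22 : ∀ (k : Type) [Field k] [CharP k 2] [IsAlgClosed k],
      ∀ (b : MvPowerSeries (Fin 4) k) (δ : Decoration k 3), Admissible b δ → UnaryVertex δ → δ.O = ∅ → δ.o = 2 → δ.GoodDir →
        DWinsTo (St := MvPowerSeries (Fin 4) k × Decoration k 3) Prod.fst
          (fun τ => GermIsNC τ.1 ∨ (Admissible τ.1 τ.2 ∧ (τ.2.head < δ.head ∨ (τ.2.head = δ.head ∧ ¬ UnaryVertex τ.2)))) (b, δ))
    (hodd : ∀ (p : ℕ), p.Prime → p ≠ 2 → ∀ (k : Type) [Field k] [CharP k p] [IsAlgClosed k],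
      ∀ (b : MvPowerSeries (Fin 4) k) (δ : Decoration k 3), Admissible b δ → 2 ≤ δ.o → UnaryVertex δ → δ.O = ∅ → δ.o = p → δ.GoodDir →
        DWinsTo (St := MvPowerSeries (Fin 4) k × Decoration k 3) Prod.fst
          (fun τ => GermIsNC τ.1 ∨ (Admissible τ.1 τ.2 ∧ (τ.2.head < δ.head ∨ (τ.2.head = δ.head ∧ ¬ UnaryVertex τ.2)))) (b, δ))
    (hhigh : ∀ (p : ℕ), p.Prime → ∀ (k : Type) [Field k] [CharP k p] [IsAlgClosed k],
      ∀ (b : MvPowerSeries (Fin 4) k) (δ : Decoration k 3), Admissible b δ → 2 ≤ δ.o → UnaryVertex δ → δ.O = ∅ → p ∣ δ.o → δ.o ≠ p →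
        δ.GoodDir →
        DWinsTo (St := MvPowerSeries (Fin 4) k × Decoration k 3) Prod.fst
          (fun τ => GermIsNC τ.1 ∨ (Admissible τ.1 τ.2 ∧ (τ.2.head < δ.head ∨ (τ.2.head = δ.head ∧ ¬ UnaryVertex τ.2)))) (b, δ)) :
    ∀ (p : ℕ), p.Prime → ∀ (k : Type) [Field k] [CharP k p] [IsAlgClosed k],
      ∀ (b : MvPowerSeries (Fin 4) k) (δ : Decoration k 3), Admissible b δ → 2 ≤ δ.o → UnaryVertex δ → δ.O = ∅ → p ∣ δ.o → δ.GoodDir →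
        DWinsTo (St := MvPowerSeries (Fin 4) k × Decoration k 3) Prod.fst
          (fun τ => GermIsNC τ.1 ∨ (Admissible τ.1 τ.2 ∧ (τ.2.head < δ.head ∨ (τ.2.head = δ.head ∧ ¬ UnaryVertex τ.2)))) (b, δ) := by
  intro p hp k _ _ _ b δ hadm ho hU hO hdvd hg
  by_cases hop : δ.o = p
  · by_cases hp2 : p = 2
    · subst hp2
      exact h22 k b δ hadm hU hO hop hg
    · exact hodd p hp hp2 k b δ hadm ho hU hO hop hg
  · exact hhigh p hp k b δ hadm ho hU hO hdvd hop hg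

/-- **FT₃ IN GOOD POSITION** (kernel-checked): Tschirnhaus witness + the good engine. -/
theorem freeTameGoodThree_of
    (hT : ∀ (p : ℕ), p.Prime → ∀ (k : Type) [Field k] [CharP k p] [IsAlgClosed k],
      ∀ (b : MvPowerSeries (Fin 4) k) (δ : Decoration k 3), Admissible b δ → 2 ≤ δ.o → δ.O = ∅ → UnaryVertex δ → ¬ p ∣ δ.o → δ.GoodDir →
        ∃ (Φ : Fin 4 → MvPowerSeries (Fin 4) k) (u : MvPowerSeries (Fin 4) k) (a : ℕ → MvPowerSeries (Fin 4) k),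
          (∀ i, constantCoeff (Φ i) = 0) ∧ IsUnit (Matrix.det (Matrix.of fun i j => coeff (Finsupp.single j 1) (Φ i))) ∧
          (∀ l ∈ δ.E, ∃ (l' : Fin 4) (v : MvPowerSeries (Fin 4) k), l' ≠ 0 ∧ constantCoeff v ≠ 0 ∧ Φ l = v * X l') ∧
          constantCoeff u ≠ 0 ∧ (∀ (i : ℕ) (n : Fin 4 →₀ ℕ), n 0 ≠ 0 → coeff n (a i) = 0) ∧ a (δ.o - 1) = 0 ∧
          subst Φ δ.f = u * (X 0 ^ δ.o + ∑ i ∈ Finset.range δ.o, a i * X 0 ^ i))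
    (hgood : ∀ (p : ℕ), p.Prime → ∀ (k : Type) [Field k] [CharP k p] [IsAlgClosed k],
      ∀ (b : MvPowerSeries (Fin 4) k) (δ : Decoration k 3) (Φ : Fin 4 → MvPowerSeries (Fin 4) k) (u : MvPowerSeries (Fin 4) k)
        (a : ℕ → MvPowerSeries (Fin 4) k),
        Admissible b δ → 2 ≤ δ.o → δ.O = ∅ → UnaryVertex δ → ¬ p ∣ δ.o → δ.GoodDir →
        (∀ i, constantCoeff (Φ i) = 0) → IsUnit (Matrix.det (Matrix.of fun i j => coeff (Finsupp.single j 1) (Φ i))) →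
        (∀ l ∈ δ.E, ∃ (l' : Fin 4) (v : MvPowerSeries (Fin 4) k), l' ≠ 0 ∧ constantCoeff v ≠ 0 ∧ Φ l = v * X l') →
        constantCoeff u ≠ 0 → (∀ (i : ℕ) (n : Fin 4 →₀ ℕ), n 0 ≠ 0 → coeff n (a i) = 0) → a (δ.o - 1) = 0 →
        subst Φ δ.f = u * (X 0 ^ δ.o + ∑ i ∈ Finset.range δ.o, a i * X 0 ^ i) →
        DWinsTo (St := MvPowerSeries (Fin 4) k × Decoration k 3) Prod.fst
          (fun τ => GermIsNC τ.1 ∨ (Admissible τ.1 τ.2 ∧ (τ.2.head < δ.head ∨ (τ.2.head = δ.head ∧ ¬ UnaryVertex τ.2)))) (b, δ)) :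
    ∀ (p : ℕ), p.Prime → ∀ (k : Type) [Field k] [CharP k p] [IsAlgClosed k],
      ∀ (b : MvPowerSeries (Fin 4) k) (δ : Decoration k 3), Admissible b δ → 2 ≤ δ.o → UnaryVertex δ → δ.O = ∅ → ¬ p ∣ δ.o → δ.GoodDir →
        DWinsTo (St := MvPowerSeries (Fin 4) k × Decoration k 3) Prod.fst
          (fun τ => GermIsNC τ.1 ∨ (Admissible τ.1 τ.2 ∧ (τ.2.head < δ.head ∨ (τ.2.head = δ.head ∧ ¬ UnaryVertex τ.2)))) (b, δ) := by
  intro p hp k _ _ _ b δ hadm ho hU hO hndvd hg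
  obtain ⟨Φ, u, a, h0, hdet, hE, hu, ha, hao, hW⟩ := hT p hp k b δ hadm ho hO hU hndvd hg
  exact hgood p hp k b δ Φ u a hadm ho hO hU hndvd hg h0 hdet hE hu ha hao hW

/-! ## §2 W₃ and FT₃ from their named leaves -/

/-- **W₃ VERBATIM ⟸ LETTER escape ∧ BAD escape ∧ C ∧ odd-`p` GOOD core ∧ higher GOOD core** (the `(2, 2)` GOOD corner supplied by
`charTwoUnaryDoublePointsGood_of_cpScope hC`).  The hypothesis list is the remaining-lemma census of v3f's `stub_coreUnaryWildThree`.
[OURS · W′|₄ kernel census] -/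
theorem coreUnaryWildThree_of_leaves
    (hL :
    ∀ (p : ℕ), p.Prime → ∀ (k : Type) [Field k] [CharP k p] [IsAlgClosed k],
      ∀ (b : MvPowerSeries (Fin 4) k) (δ : Decoration k 3) (l : Fin 4), Admissible b δ → 2 ≤ δ.o → UnaryVertex δ → δ.LetterDir l →
        DWinsTo (St := MvPowerSeries (Fin 4) k × Decoration k 3) Prod.fst
          (fun τ => (GermIsNC τ.1 ∨ (Admissible τ.1 τ.2 ∧ (τ.2.head < δ.head ∨ (τ.2.head = δ.head ∧ ¬ UnaryVertex τ.2)))) ∨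
            (Admissible τ.1 τ.2 ∧ τ.2.head = δ.head ∧ UnaryVertex τ.2 ∧ (τ.2.GoodDir ∨ τ.2.BadDir))) (b, δ))
    (hB :
    ∀ (p : ℕ), p.Prime → ∀ (k : Type) [Field k] [CharP k p] [IsAlgClosed k],
      ∀ (b : MvPowerSeries (Fin 4) k) (δ : Decoration k 3), Admissible b δ → 2 ≤ δ.o → UnaryVertex δ → δ.BadDir →
        DWinsTo (St := MvPowerSeries (Fin 4) k × Decoration k 3) Prod.fst
          (fun τ => (GermIsNC τ.1 ∨ (Admissible τ.1 τ.2 ∧ (τ.2.head < δ.head ∨ (τ.2.head = δ.head ∧ ¬ UnaryVertex τ.2)))) ∨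
            (Admissible τ.1 τ.2 ∧ τ.2.head = δ.head ∧ UnaryVertex τ.2 ∧ τ.2.GoodDir)) (b, δ))
    (hC :
    ∀ (p : ℕ), p.Prime → ∀ (k : Type) [Field k] [CharP k p] [IsAlgClosed k],
      ∀ (b : MvPowerSeries (Fin 4) k) (δ : Decoration k 3) (Φ : Fin 4 → MvPowerSeries (Fin 4) k) (u hW : MvPowerSeries (Fin 4) k)
        (a : ℕ → MvPowerSeries (Fin 4) k),
        Admissible b δ → δ.O = ∅ → δ.o = p →
        (∀ i, constantCoeff (Φ i) = 0) → IsUnit (Matrix.det (Matrix.of fun i j => coeff (Finsupp.single j 1) (Φ i))) →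
        (∀ l ∈ δ.E, ∃ (l' : Fin 4) (v : MvPowerSeries (Fin 4) k), l' ≠ 0 ∧ constantCoeff v ≠ 0 ∧ Φ l = v * X l') →
        constantCoeff u ≠ 0 → (∀ i (n : Fin 4 →₀ ℕ), n 0 ≠ 0 → coeff n (a i) = 0) →
        hW = X 0 ^ p + ∑ i ∈ Finset.range p, a i * X 0 ^ i → subst Φ δ.f = u * hW →
        Irreducible hW →
        ((∀ i, 0 < i → i < p → a i = 0) ∨
          (∃ G : MvPowerSeries (Fin 4) k, (hW ∣ G ^ p + ∑ i ∈ Finset.range p, a i * G ^ i) ∧ ¬ (hW ∣ G - X 0))) →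
        DWinsTo (St := MvPowerSeries (Fin 4) k × Decoration k 3) Prod.fst
          (fun τ => GermIsNC τ.1 ∨ (Admissible τ.1 τ.2 ∧ (τ.2.head < δ.head ∨ (τ.2.head = δ.head ∧ ¬ UnaryVertex τ.2)))) (b, δ))
    (hodd :
    ∀ (p : ℕ), p.Prime → p ≠ 2 → ∀ (k : Type) [Field k] [CharP k p] [IsAlgClosed k],
      ∀ (b : MvPowerSeries (Fin 4) k) (δ : Decoration k 3), Admissible b δ → 2 ≤ δ.o → UnaryVertex δ → δ.O = ∅ → δ.o = p → δ.GoodDir →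
        DWinsTo (St := MvPowerSeries (Fin 4) k × Decoration k 3) Prod.fst
          (fun τ => GermIsNC τ.1 ∨ (Admissible τ.1 τ.2 ∧ (τ.2.head < δ.head ∨ (τ.2.head = δ.head ∧ ¬ UnaryVertex τ.2)))) (b, δ))
    (hhigh :
    ∀ (p : ℕ), p.Prime → ∀ (k : Type) [Field k] [CharP k p] [IsAlgClosed k],
      ∀ (b : MvPowerSeries (Fin 4) k) (δ : Decoration k 3), Admissible b δ → 2 ≤ δ.o → UnaryVertex δ → δ.O = ∅ → p ∣ δ.o → δ.o ≠ p →
        δ.GoodDir →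
        DWinsTo (St := MvPowerSeries (Fin 4) k × Decoration k 3) Prod.fst
          (fun τ => GermIsNC τ.1 ∨ (Admissible τ.1 τ.2 ∧ (τ.2.head < δ.head ∨ (τ.2.head = δ.head ∧ ¬ UnaryVertex τ.2)))) (b, δ)) :
    ∀ (p : ℕ), p.Prime → ∀ (k : Type) [Field k] [CharP k p] [IsAlgClosed k], CoreUnaryWild p k 3 := by
  intro p hp k _ _ _ b δ hadm ho hU hO hdvd
  exact unaryThree_of_positions hp (fun o => p ∣ o) (hL p hp k) (hB p hp k)
    (coreUnaryWildGoodThree_of_orders (charTwoUnaryDoublePointsGood_of_cpScope hC) hodd hhigh p hp k)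
    b δ hadm ho hU hO hdvd

/-- **FT₃ VERBATIM ⟸ LETTER escape ∧ BAD escape ∧ FT₃-GOOD** (Tschirnhaus witness proved).  The hypothesis list is the remaining-lemma census of
v3f's `stub_freeTameThree`. [OURS · W′|₄ kernel census] -/
theorem freeTameThree_of_leaves
    (hL :
    ∀ (p : ℕ), p.Prime → ∀ (k : Type) [Field k] [CharP k p] [IsAlgClosed k],
      ∀ (b : MvPowerSeries (Fin 4) k) (δ : Decoration k 3) (l : Fin 4), Admissible b δ → 2 ≤ δ.o → UnaryVertex δ → δ.LetterDir l →
        DWinsTo (St := MvPowerSeries (Fin 4) k × Decoration k 3) Prod.fst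
          (fun τ => (GermIsNC τ.1 ∨ (Admissible τ.1 τ.2 ∧ (τ.2.head < δ.head ∨ (τ.2.head = δ.head ∧ ¬ UnaryVertex τ.2)))) ∨
            (Admissible τ.1 τ.2 ∧ τ.2.head = δ.head ∧ UnaryVertex τ.2 ∧ (τ.2.GoodDir ∨ τ.2.BadDir))) (b, δ))
    (hB :
    ∀ (p : ℕ), p.Prime → ∀ (k : Type) [Field k] [CharP k p] [IsAlgClosed k],
      ∀ (b : MvPowerSeries (Fin 4) k) (δ : Decoration k 3), Admissible b δ → 2 ≤ δ.o → UnaryVertex δ → δ.BadDir →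
        DWinsTo (St := MvPowerSeries (Fin 4) k × Decoration k 3) Prod.fst
          (fun τ => (GermIsNC τ.1 ∨ (Admissible τ.1 τ.2 ∧ (τ.2.head < δ.head ∨ (τ.2.head = δ.head ∧ ¬ UnaryVertex τ.2)))) ∨
            (Admissible τ.1 τ.2 ∧ τ.2.head = δ.head ∧ UnaryVertex τ.2 ∧ τ.2.GoodDir)) (b, δ))
    (hgood :
    ∀ (p : ℕ), p.Prime → ∀ (k : Type) [Field k] [CharP k p] [IsAlgClosed k],
      ∀ (b : MvPowerSeries (Fin 4) k) (δ : Decoration k 3) (Φ : Fin 4 → MvPowerSeries (Fin 4) k) (u : MvPowerSeries (Fin 4) k)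
        (a : ℕ → MvPowerSeries (Fin 4) k),
        Admissible b δ → 2 ≤ δ.o → δ.O = ∅ → UnaryVertex δ → ¬ p ∣ δ.o → δ.GoodDir →
        (∀ i, constantCoeff (Φ i) = 0) → IsUnit (Matrix.det (Matrix.of fun i j => coeff (Finsupp.single j 1) (Φ i))) →
        (∀ l ∈ δ.E, ∃ (l' : Fin 4) (v : MvPowerSeries (Fin 4) k), l' ≠ 0 ∧ constantCoeff v ≠ 0 ∧ Φ l = v * X l') →
        constantCoeff u ≠ 0 → (∀ (i : ℕ) (n : Fin 4 →₀ ℕ), n 0 ≠ 0 → coeff n (a i) = 0) → a (δ.o - 1) = 0 →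
        subst Φ δ.f = u * (X 0 ^ δ.o + ∑ i ∈ Finset.range δ.o, a i * X 0 ^ i) →
        DWinsTo (St := MvPowerSeries (Fin 4) k × Decoration k 3) Prod.fst
          (fun τ => GermIsNC τ.1 ∨ (Admissible τ.1 τ.2 ∧ (τ.2.head < δ.head ∨ (τ.2.head = δ.head ∧ ¬ UnaryVertex τ.2)))) (b, δ)) :
    ∀ (p : ℕ), p.Prime → ∀ (k : Type) [Field k] [CharP k p] [IsAlgClosed k], FreeTame p k 3 := by
  intro p hp k _ _ _ b δ hadm ho hO hU hndvd
  exact unaryThree_of_positions hp (fun o => ¬ p ∣ o) (hL p hp k) (hB p hp k)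
    (freeTameGoodThree_of tschirnhausWitnessOfGood hgood p hp k) b δ hadm ho hU hO hndvd

end UnaryPositionCensus

end TameFourTupleDrop

end Summit.ResolutionOfSingularities.ResolutionOfSingularities.Theorems

end
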